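import Mathlib
import HarnessLib
import Summits.NavierStokesRegularity.NavierStokesRegularity.Theorems.RellichScarTypeIBlowupProfile
import Summits.NavierStokesRegularity.NavierStokesRegularity.Theorems.LocalSineTubeDoorLocalPointZoomData
import Summits.NavierStokesRegularity.NavierStokesRegularity.Theorems.LocalIrrotationalScarDoorZoomApex

/-!
# STAGED door S15 `LocalIrrotationalScarDoor` (nsreg-p1 ROUND-14), zoom crux `K1Rep` (`LocalPointZoomScarCurlRep`) —
# support tools, part 3: the zooms on cylinders REACHING THE TOP TIME, away from the apex axis

Step (iii-a) of the `K1Rep` plan (ROUND-14 §4 Day 2).  Companion of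
`…LocalSineTubeDoorLocalPointZoomData.localZoomFrame_data` (p6 g5: the zooms `Zⱼ = λⱼ•v'(λⱼ²·, λⱼ·)` of the tree frame
on the unit cylinder about `(−½, y)`, where the TIME rate bounds them): here the cylinder is `Q((0,x), r₀)`,
`0 < r₀ ≤ ‖x‖/2`, whose top is the blow-up time itself, and the velocity bound comes from the SPACE–TIME (apex)
hypothesis `‖u(t,x')‖ (‖x' − x₀‖ + √(ν(T−t))) ≤ M` (`…LocalIrrotationalScarDoorZoomApex.norm_zoom_le_apex`): away from
the axis `‖y‖ ≥ r₀` the zooms are bounded by `(M/ν)/r₀` up to the top.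

* `localZoomFrame_data_top` — eventually in `j`: `(Zⱼ, πⱼ)` is a distributional Navier–Stokes solution on
  `Q((0,x), r₀)`, `‖Zⱼ‖ ≤ (M/ν)/r₀` a.e. there, and `∫_{Q((0,x),r₀)} |πⱼ|^{3/2} ≤ (2‖x‖+2)² Ks` (Seregin's scaled
  pressure energy `cknD ≤ Ks` at the singular origin of `v'`, zoom covariance `cknD_nsZoom`, monotonicity
  `cknD_le_mul_of_subset`).
These are exactly the three inputs of the tree's quantitative local regularity
`NSBoundedHigherRegularityBounds_holds` (Seregin–Šverák 2009 §2), uniformly in `j`.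

Seat nsreg-p6 g7; helper toward the S15 zoom crux (anchor `--supports stmt-NavierStokesRegularity-11719`).
WHAT THIS IS NOT: not NS regularity; not `K1Rep`.
-/

noncomputable section

open MeasureTheory Set Function Filter Topology TopologicalSpace Metric
open Literature.Analysis Literature.Analysis.FluidPDE Literature.Analysis.FluidPDE.SereginSverak2009
open Summit.NavierStokesRegularity.NavierStokesRegularity.Theorems
open Summit.NavierStokesRegularity.NavierStokesRegularity.Theorems.LocalIrrotationalScarDoorZoomApex
open scoped NNReal ENNReal

-- the summit and its single sub-problem share the name (CONVENTIONS §1), as in every Theorems file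
set_option linter.dupNamespace false

namespace Summit.NavierStokesRegularity.NavierStokesRegularity.Theorems.LocalIrrotationalScarDoorZoomDataTop

/-- Membership in the top cylinder `Q((0,x), r)`. -/
theorem mem_parabolicCylinder_top_iff {r : ℝ} {x : EuclideanSpace ℝ (Fin 3)} {w : ℝ × EuclideanSpace ℝ (Fin 3)} :
    w ∈ parabolicCylinder r (((0 : ℝ), x) : ℝ × EuclideanSpace ℝ (Fin 3)) ↔
      (-r ^ 2 < w.1 ∧ w.1 < 0) ∧ dist w.2 x < r := by
  simp only [parabolicCylinder, mem_prod, mem_Ioo, mem_ball, zero_sub]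

/-- **The zooms on a top cylinder away from the axis: distributional equations, apex sup bound, pressure mass**
(eventually in `j`; see the module docstring). -/
theorem localZoomFrame_data_top {ν T : ℝ} (hν : 0 < ν) (hT : 0 < T)
    {u : ℝ → EuclideanSpace ℝ (Fin 3) → EuclideanSpace ℝ (Fin 3)} {x₀ : EuclideanSpace ℝ (Fin 3)} {ρ M : ℝ}
    (hρ : 0 < ρ)
    (hM : ∀ t ∈ Ico 0 T, T - ρ ^ 2 < t → ∀ x ∈ ball x₀ ρ,
      ‖u t x‖ * (‖x - x₀‖ + Real.sqrt (ν * (T - t))) ≤ M)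
    {R : ℝ} (hR : 0 < R) {v' : ℝ → EuclideanSpace ℝ (Fin 3) → EuclideanSpace ℝ (Fin 3)}
    {π' : ℝ → EuclideanSpace ℝ (Fin 3) → ℝ}
    (hball1 : IsSuitableWeakSolutionInBall 1 0 v' π') {lam : ℕ → ℝ} (hlam : ∀ j, 0 < lam j)
    (hlam0 : Tendsto lam atTop (𝓝 0)) {Ks : ℝ≥0} {r₁ : ℝ} (hr₁ : 0 < r₁) (hr₁1 : r₁ ≤ 1)
    (hKs : ∀ r ∈ Ioc (0 : ℝ) r₁, cknD r (0 : ℝ × EuclideanSpace ℝ (Fin 3)) π' ≤ Ks)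
    (hpt : ∀ (j : ℕ) (s : ℝ) (y : EuclideanSpace ℝ (Fin 3)),
      ((lam j) • stPull ((lam j) ^ 2) (lam j) (0 : ℝ) (0 : EuclideanSpace ℝ (Fin 3)) v') s y =
        ((R * (lam j / 2)) / ν) • u (T + (R * (lam j / 2)) ^ 2 * s / ν) (x₀ + (R * (lam j / 2)) • y))
    {x : EuclideanSpace ℝ (Fin 3)} {r₀ : ℝ} (hr₀ : 0 < r₀) (hr₀x : r₀ ≤ ‖x‖ / 2) :
    ∃ J : ℕ, ∀ j, J ≤ j →
      IsDistributionalNSSolutionOn (parabolicCylinderOpens r₀ (((0 : ℝ), x) : ℝ × EuclideanSpace ℝ (Fin 3))) 1 0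
        ((lam j) • stPull ((lam j) ^ 2) (lam j) (0 : ℝ) (0 : EuclideanSpace ℝ (Fin 3)) v')
        ((lam j) ^ 2 • stPull ((lam j) ^ 2) (lam j) (0 : ℝ) (0 : EuclideanSpace ℝ (Fin 3)) π') ∧
      (∀ᵐ w ∂(volume.restrict (parabolicCylinder r₀ (((0 : ℝ), x) : ℝ × EuclideanSpace ℝ (Fin 3)))),
        ‖((lam j) • stPull ((lam j) ^ 2) (lam j) (0 : ℝ) (0 : EuclideanSpace ℝ (Fin 3)) v') w.1 w.2‖ ≤
          (M / ν) / r₀) ∧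
      ∫⁻ w in parabolicCylinder r₀ (((0 : ℝ), x) : ℝ × EuclideanSpace ℝ (Fin 3)),
          ‖((lam j) ^ 2 • stPull ((lam j) ^ 2) (lam j) (0 : ℝ) (0 : EuclideanSpace ℝ (Fin 3)) π') w.1 w.2‖ₑ ^
            (3 / 2 : ℝ) ≤ ((((2 * ‖x‖ + 2) ^ 2).toNNReal * Ks : ℝ≥0) : ℝ≥0∞) := by
  have hΛpos : ∀ j, 0 < (R * (lam j / 2)) := fun j => mul_pos hR (half_pos (hlam j))
  have hΛ0 : Tendsto (fun j => (R * (lam j / 2))) atTop (𝓝 0) := by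
    simpa using (hlam0.div_const 2).const_mul R
  -- the enclosing cylinder `Q(0, a)`
  set a : ℝ := 2 * ‖x‖ + 2 with ha_def
  have ha : 0 < a := by positivity
  have hxa : ‖x‖ < a := by rw [ha_def]; linarith [norm_nonneg x]
  have hr₀a : r₀ < a := by linarith [norm_nonneg x]
  have hQa : parabolicCylinder r₀ (((0 : ℝ), x) : ℝ × EuclideanSpace ℝ (Fin 3)) ⊆
      parabolicCylinder a (0 : ℝ × EuclideanSpace ℝ (Fin 3)) := by
    intro w hw
    rw [mem_parabolicCylinder_top_iff] at hw
    obtain ⟨⟨h1, h2⟩, h3⟩ := hw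
    rw [SuitableCompactness.mem_parabolicCylinder_zero]
    have hr2 : r₀ ^ 2 < a ^ 2 := by nlinarith
    refine ⟨⟨by linarith, h2⟩, ?_⟩
    calc ‖w.2‖ ≤ dist w.2 x + ‖x‖ := by simpa [dist_zero_right] using dist_triangle w.2 x 0
      _ < r₀ + ‖x‖ := by linarith
      _ < a := by rw [ha_def]; linarith [norm_nonneg x, hr₀x]
  -- thresholds: the apex region and `λⱼ a ≤ r₁ ≤ 1`
  have hevA : ∀ᶠ j in atTop, lam j < r₁ / a := hlam0 (Iio_mem_nhds (by positivity))
  have hevR := eventually_zoom_region (x₀ := x₀) hν hT hρ hΛpos hΛ0 ha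
  obtain ⟨J, hJ⟩ := eventually_atTop.1 (hevA.and hevR)
  have hlamA : ∀ j, J ≤ j → lam j * a ≤ r₁ := fun j hj => ((lt_div_iff₀ ha).1 (hJ j hj).1).le
  have hlam1 : ∀ j, J ≤ j → lam j * a ≤ 1 := fun j hj => (hlamA j hj).trans hr₁1
  refine ⟨J, fun j hj => ⟨?_, ?_, ?_⟩⟩
  · -- (i) the distributional equations on `Q((0,x), r₀) ⊆ Q(0, 1/λⱼ)` (zoom-out of the `Q(0,1)` class)
    have hzo := hball1.zoomOut (hlam j)
    have hl := hlam j
    have hle : parabolicCylinderOpens r₀ (((0 : ℝ), x) : ℝ × EuclideanSpace ℝ (Fin 3)) ≤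
        parabolicCylinderOpens (1 / lam j) (0 : ℝ × EuclideanSpace ℝ (Fin 3)) := by
      intro w hw
      change w ∈ parabolicCylinder r₀ (((0 : ℝ), x) : ℝ × EuclideanSpace ℝ (Fin 3)) at hw
      change w ∈ parabolicCylinder (1 / lam j) (0 : ℝ × EuclideanSpace ℝ (Fin 3))
      have hwa := hQa hw
      rw [SuitableCompactness.mem_parabolicCylinder_zero] at hwa ⊢
      obtain ⟨⟨h1, h2⟩, h3⟩ := hwa
      have hinv : a ≤ 1 / lam j := by rw [le_div_iff₀ hl, mul_comm]; exact hlam1 j hj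
      have h4 : a ^ 2 ≤ (1 / lam j) ^ 2 := pow_le_pow_left₀ ha.le hinv 2
      exact ⟨⟨by linarith, h2⟩, lt_of_lt_of_le h3 hinv⟩
    exact (IsSuitableWeakSolutionOn.mono_holds hzo.1 hle).distributional
  · -- (ii) the uniform bound from the apex hypothesis
    refine ae_restrict_of_forall_mem (isOpen_parabolicCylinder _ _).measurableSet fun w hw => ?_
    have hwa := hQa hw
    obtain ⟨ht, hρt, hy⟩ := (hJ j hj).2 w hwa
    rw [mem_parabolicCylinder_top_iff] at hw
    obtain ⟨⟨h1, h2⟩, h3⟩ := hw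
    rw [hpt]
    refine (norm_zoom_le_apex hν hM (hΛpos j) h2 ht hρt hy).trans ?_
    -- `‖w.2‖ ≥ r₀`
    have hy0 : r₀ ≤ ‖w.2‖ := by
      have : ‖x‖ ≤ ‖w.2‖ + dist w.2 x := by
        have := dist_triangle x w.2 0
        simp only [dist_zero_right] at this
        rw [dist_comm] at this
        linarith
      linarith
    have hden : r₀ ≤ ‖w.2‖ + Real.sqrt (-w.1) := hy0.trans (le_add_of_nonneg_right (Real.sqrt_nonneg _))
    have hMν : 0 ≤ M / ν := by
      -- `M ≥ 0`: the hypothesis at the zoomed point is a product of nonnegatives bounded by `M`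
      have h := hM _ ht hρt _ hy
      exact div_nonneg ((mul_nonneg (norm_nonneg _) (add_nonneg (norm_nonneg _) (Real.sqrt_nonneg _))).trans h)
        hν.le
    exact div_le_div_of_nonneg_left hMν hr₀ hden
  · -- (iii) the pressure mass on `Q((0,x), r₀)`
    have hl := hlam j
    have hsubQ : parabolicCylinder (lam j * r₀)
        (stAffine ((lam j) ^ 2) (lam j) (0 : ℝ) (0 : EuclideanSpace ℝ (Fin 3)) (((0 : ℝ), x) : ℝ × EuclideanSpace ℝ (Fin 3))) ⊆
        parabolicCylinder (lam j * a) (0 : ℝ × EuclideanSpace ℝ (Fin 3)) := by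
      intro w hw
      simp only [parabolicCylinder, stAffine, mem_prod, mem_Ioo, mem_ball, Prod.fst_zero,
        Prod.snd_zero, zero_add, mul_zero, add_zero, zero_sub, dist_zero_right] at hw ⊢
      obtain ⟨⟨h1, h2⟩, h3⟩ := hw
      have hl2 : 0 < lam j ^ 2 := pow_pos hl 2
      have h4 : (lam j * r₀) ^ 2 < (lam j * a) ^ 2 := by
        rw [mul_pow, mul_pow]; exact mul_lt_mul_of_pos_left (by nlinarith) hl2
      refine ⟨⟨by nlinarith, h2⟩, ?_⟩
      calc ‖w.2‖ ≤ dist w.2 ((lam j) • x) + ‖(lam j) • x‖ := by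
            simpa [dist_zero_right] using dist_triangle w.2 ((lam j) • x) 0
        _ < lam j * r₀ + lam j * ‖x‖ := by
            rw [norm_smul, Real.norm_of_nonneg hl.le]; linarith
        _ < lam j * a := by
            rw [ha_def]
            have : r₀ + ‖x‖ < 2 * ‖x‖ + 2 := by linarith [norm_nonneg x, hr₀x]
            nlinarith
    have hρ' : 0 < lam j * a := by positivity
    have hρ'' : 0 < lam j * r₀ := by positivity
    have hD : cknD (lam j * a) (0 : ℝ × EuclideanSpace ℝ (Fin 3)) π' ≤ Ks := hKs (lam j * a) ⟨hρ', hlamA j hj⟩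
    have hr0 : ENNReal.ofReal r₀ ≠ 0 := by rw [ne_eq, ENNReal.ofReal_eq_zero, not_le]; exact hr₀
    have hsplit : ∫⁻ w in parabolicCylinder r₀ (((0 : ℝ), x) : ℝ × EuclideanSpace ℝ (Fin 3)),
        ‖((lam j) ^ 2 • stPull ((lam j) ^ 2) (lam j) (0 : ℝ) (0 : EuclideanSpace ℝ (Fin 3)) π') w.1 w.2‖ₑ ^
          (3 / 2 : ℝ) = ENNReal.ofReal r₀ ^ 2 * cknD r₀ (((0 : ℝ), x) : ℝ × EuclideanSpace ℝ (Fin 3))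
          ((lam j) ^ 2 • stPull ((lam j) ^ 2) (lam j) (0 : ℝ) (0 : EuclideanSpace ℝ (Fin 3)) π') := by
      rw [cknD, ← mul_assoc, ENNReal.mul_inv_cancel (pow_ne_zero 2 hr0) (by simp), one_mul]
    calc ∫⁻ w in parabolicCylinder r₀ (((0 : ℝ), x) : ℝ × EuclideanSpace ℝ (Fin 3)),
          ‖((lam j) ^ 2 • stPull ((lam j) ^ 2) (lam j) (0 : ℝ) (0 : EuclideanSpace ℝ (Fin 3)) π') w.1 w.2‖ₑ ^
            (3 / 2 : ℝ)
        = ENNReal.ofReal r₀ ^ 2 * cknD (lam j * r₀)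
            (stAffine ((lam j) ^ 2) (lam j) (0 : ℝ) (0 : EuclideanSpace ℝ (Fin 3))
              (((0 : ℝ), x) : ℝ × EuclideanSpace ℝ (Fin 3))) π' := by
          rw [hsplit, cknD_nsZoom hl hr₀ _ _ _ _]
      _ ≤ ENNReal.ofReal r₀ ^ 2 * (ENNReal.ofReal ((lam j * a) / (lam j * r₀)) ^ 2 *
            cknD (lam j * a) (0 : ℝ × EuclideanSpace ℝ (Fin 3)) π') := by
          gcongr
          exact cknD_le_mul_of_subset hρ' hρ'' hsubQ π'
      _ ≤ ENNReal.ofReal r₀ ^ 2 * (ENNReal.ofReal (a / r₀) ^ 2 * Ks) := by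
          rw [show lam j * a / (lam j * r₀) = a / r₀ by field_simp]
          gcongr
      _ = (((a ^ 2).toNNReal * Ks : ℝ≥0) : ℝ≥0∞) := by
          rw [← mul_assoc, ← mul_pow, ← ENNReal.ofReal_mul hr₀.le, mul_div_cancel₀ _ hr₀.ne',
            ← ENNReal.ofReal_pow ha.le, ENNReal.coe_mul]
          rfl

end Summit.NavierStokesRegularity.NavierStokesRegularity.Theorems.LocalIrrotationalScarDoorZoomDataTop

end
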